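/-
Copyright (c) 2026. All rights reserved.
Released under Apache 2.0 license as described in the file LICENSE.
-/
import Literature.AlgebraicGeometry.Pohlmann1968.AbelianCMFieldStabilizerExceptionalClasses
import Literature.NumberTheory.ComplexMultiplication.DegenerateCMTypesAbelianStabilizerIndexBound
import HarnessLib

/-!
# Abelian CM fields: exceptional Hodge classes on `A` ⟺ an odd character, trivial on the stabiliser, annihilated by
# the type

SETTING.  `K` an abelian CM field, `G = Gal(K/ℚ)`, `ρ ∈ G` complex conjugation (tree `conjGal`), `φ₀ : K → ℂ` a
base embedding, `Φ` a CM type of `K` read on `G` as `T = {g ∈ G : σ_g = φ₀ ∘ g⁻¹ ∈ Φ}` (Shimura's indexing, tree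
`embOf`), `Stab(T) = {g : Tg = T}`.  The tree decides the presence of exceptional Hodge classes on an abelian variety
`A` of type `(K; Φ)` by the field-level invariant `2·|Stab(Φ)|·(Rank(Φ) − 1) = [K:ℚ]`
(`AbelianCMFieldStabilizerExceptionalClasses`, g39-#9), and it evaluates the group-level invariant
`2·|Stab(T)|·(rank(T) − 1) ≤ |G|` through characters (`DegenerateCMTypesAbelianStabilizerIndexBound`, g39-#6:
equality iff every odd character trivial on `Stab(T)` has `Ŝ(χ) = Σ_{t ∈ T} χ(t) ≠ 0`).  THIS FILE supplies the
dictionary `Stab(Φ) = Stab(T)` for abelian `K` (§1) and reads off the CHARACTER CRITERION: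

> **Theorem** (`exists_exceptional_iff_exists_oddCharacter`).  `K` abelian CM, `Φ` ANY CM type, `A` ANY abelian
> variety of type `(K; Φ)`.  `A` carries an exceptional Hodge class (a rational `(m,m)`-class outside `Dᵐ(A) ⊗ ℂ` for
> some `m`) **iff there is a character `χ` of `G` with `χ(ρ) = −1`, `χ ≡ 1` on `Stab(T)`, and `Σ_{t ∈ T} χ(t) = 0`.**
> Equivalently (`forall_hodgeClassSpan_eq_iff_forall_oddCharacter`) `Bᵐ(A) ⊗ ℂ = Dᵐ(A) ⊗ ℂ` for all `m` iff every odd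
> character trivial on `Stab(T)` survives.

For PRIMITIVE `Φ` (`Stab(T) = 1`) this is Kubota–Pohlmann–White: `A` (simple) has a sporadic cycle iff `Φ` is
degenerate iff some odd character is annihilated by `T` ([Kubota1965] §2, [Pohlmann1968] Thm. 1, [White1993SporadicCycles]
§4 Thm. 3); the stabiliser condition is what survives of it for imprimitive types (the odd characters NOT trivial on
`Stab(T)` are always annihilated, tree `survivor_apply_eq_one_of_forall_mul_mem_iff`, and carry no geometric
information: they only record that `A ≅ B^h` is a power).

* §1 `embOf_inv_mul` (`σ_{g⁻¹t} = σ_t ∘ g`), `mem_twistStabilizer_iff_forall_comp_mem_iff` (any `K`),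
  `forall_comp_mem_iff_iff_forall_mul_mem_iff`, **`mem_twistStabilizer_iff_forall_mul_mem_iff`**,
  `natCard_twistStabilizer_eq_card_stabilizer` (abelian `K`: `|Stab(Φ)| = |Stab(T)|`).
* §2 `two_mul_card_stabilizer_mul_eq_iff_forall_hodgeClassSpan_eq` (group-level invariant ⟺ `B = D` on `A`),
  **`forall_hodgeClassSpan_eq_iff_forall_oddCharacter`**, **`exists_exceptional_iff_exists_oddCharacter`**.

HONEST SCOPE.  Dictionary + assembly (g39-#6, g39-#9); abelian `K` only (for non-abelian Galois `K` the group-level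
type is not a CM type for a central `ρ` in general and the character calculus does not apply).  THEOREMS ONLY: no
definition, no named fact, no instance, no `sorry`.

## References

* [Kubota1965] T. Kubota, *On the field extension by complex multiplication*, Trans. AMS 118 (1965), §2, §4 Lemma 2.
* [Pohlmann1968] H. Pohlmann, *Algebraic cycles on abelian varieties of complex multiplication type*, Ann. of Math. 88
  (1968), Thm. 1, §3.
* [White1993SporadicCycles] S. P. White, *Sporadic cycles on CM abelian varieties*, Compositio Math. 88 (1993), §4 Thm. 3.
* [Gordon1999HodgeAVSurvey] B. B. Gordon, *A survey of the Hodge conjecture for abelian varieties*, Thm. 6.4, §9.2.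
* [Shimura1998] G. Shimura, *Abelian Varieties with Complex Multiplication and Modular Functions*, §8.1, §8.2 Prop. 26,
  §18.2 Lemma (i).
* [BCLLMNO2015] I. Bouw et al., *Bad reduction of genus three curves with complex multiplication*, §3 Prop. 3.3.

## Provenance

Lane `lit-hodgefound` (Track 2, Layer A5), seat `lit-hodgefound-p10` generation 39, row g39-#11; neighbours cited by
name, nothing restated: `AbelianCMFieldStabilizerExceptionalClasses` (g39-#9), `DegenerateCMTypesAbelianStabilizerIndexBound`
(g39-#6: `AbelianStabilizer.two_mul_card_stabilizer_mul_eq_iff`, `forall_mul_inv_mem_iff`),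
`CMTypeRankCharactersNumberField` (`embOf`, `embOf_bijective`, `cmTypeRank_eq_typeRank_gal`, `isCMTypeWith_gal`),
`CMTypeEquivalenceClassesCount` (`twistStabilizer`, `mem_twistStabilizer_iff`), `CMTorusEquivalentCMTypes`
(`comp_mem_twist_iff`, `mem_twist_iff`), `EmbeddingActionFaithful` (`conjGal`).
-/

open scoped BigOperators NumberField IsMulCommutative Classical
open NumberField Module CategoryTheory CategoryTheory.Limits IntermediateField

namespace Literature.AlgebraicGeometry.Pohlmann1968

open scoped Literature.NumberTheory.ComplexMultiplication
open Literature.NumberTheory.ComplexMultiplication (inducedCMType mem_inducedCMType_iff twistStabilizer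
  mem_twistStabilizer_iff comp_mem_twist_iff mem_twist_iff typeRank IsCMTypeWith conjGal conjGal_apply)
open Literature.NumberTheory.ComplexMultiplication.CyclicCMType.AbelianStabilizer (two_mul_card_stabilizer_mul_eq_iff
  forall_mul_inv_mem_iff)
open Literature.AlgebraicGeometry.Motives (CMType AbelianVariety)
open Literature.AlgebraicGeometry.HodgeTheory
open Literature.AlgebraicGeometry.VanGeemen1994 (hodgeClassSpan)
open Literature.Barriers.HodgeConjecture (divisorClassesSpan)
open Literature.AlgebraicGeometry.ComplexMultiplication (IsCMTypeRealisation)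

variable {K : Type} [Field K] [NumberField K] [IsCMField K]
  {A : AbelianVariety ℂ} {ι : 𝓞 K →+* End A} {θ : K →+* Module.End ℂ (complexBetti A.X 1)}

/-! ## §1 The dictionary `Stab(Φ) = Stab(T)` -/

section Dictionary

omit [IsCMField K] in
/-- **`σ_{g⁻¹t} = σ_t ∘ g`** (`σ_g = φ₀ ∘ g⁻¹`). [cite: Shimura1998, §8.1] -/
theorem embOf_inv_mul (φ₀ : K →+* ℂ) (g t : K ≃ₐ[ℚ] K) :
    embOf φ₀ (g⁻¹ * t) = (embOf φ₀ t).comp (g : K →+* K) := by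
  refine RingHom.ext fun x => ?_
  show φ₀ ((g⁻¹ * t).symm x) = φ₀ (t.symm (g x))
  congr 1

omit [IsCMField K] in
/-- **`g ∈ Stab(Φ) ⟺ (φ ∘ g ∈ Φ ⟺ φ ∈ Φ for every embedding φ)`** (any number field `K`; `Stab(Φ) = {g : Φg = Φ}`,
`Φg = {φ ∘ g}`). [cite: BCLLMNO2015, §3 Prop. 3.3] [cite: Shimura1998, §8.2] -/
theorem mem_twistStabilizer_iff_forall_comp_mem_iff (Φ : CMType K) (g : K ≃ₐ[ℚ] K) :
    g ∈ twistStabilizer Φ ↔ ∀ φ : K →+* ℂ, φ.comp (g : K →+* K) ∈ Φ.1 ↔ φ ∈ Φ.1 := by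
  constructor
  · intro hg φ
    have h := comp_mem_twist_iff g Φ φ
    rwa [(mem_twistStabilizer_iff Φ g).1 hg] at h
  · intro hstab
    rw [mem_twistStabilizer_iff]
    apply Subtype.ext
    ext ψ
    have e : (ψ.comp (g.symm : K →+* K)).comp (g : K →+* K) = ψ := RingHom.ext fun x => by
      show ψ (g.symm (g x)) = ψ x
      rw [AlgEquiv.symm_apply_apply]
    rw [mem_twist_iff]
    exact (hstab (ψ.comp (g.symm : K →+* K))).symm.trans (by rw [e])

variable [Normal ℚ K] [IsMulCommutative (K ≃ₐ[ℚ] K)]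

omit [IsCMField K] in
/-- **Abelian `K`: `Φ ∘ g = Φ ⟺ Tg = T`** for the type `T = {t : σ_t ∈ Φ}` read on the Galois group
(`σ_t ∘ g = σ_{g⁻¹t}`, and `T` is `g⁻¹`-stable iff `g`-stable). [cite: Kubota1965, §4 Lemma 2] [cite: Shimura1998, §8.1] -/
theorem forall_comp_mem_iff_iff_forall_mul_mem_iff (φ₀ : K →+* ℂ) (Φ : CMType K) (g : K ≃ₐ[ℚ] K) :
    (∀ φ : K →+* ℂ, φ.comp (g : K →+* K) ∈ Φ.1 ↔ φ ∈ Φ.1) ↔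
      ∀ t : K ≃ₐ[ℚ] K, t * g ∈ (Finset.univ.filter fun s : K ≃ₐ[ℚ] K => embOf φ₀ s ∈ Φ.1) ↔
        t ∈ (Finset.univ.filter fun s : K ≃ₐ[ℚ] K => embOf φ₀ s ∈ Φ.1) := by
  -- both sides say: `T` is stable under `t ↦ g⁻¹ t`
  have key : (∀ φ : K →+* ℂ, φ.comp (g : K →+* K) ∈ Φ.1 ↔ φ ∈ Φ.1) ↔
      ∀ t : K ≃ₐ[ℚ] K, t * g⁻¹ ∈ (Finset.univ.filter fun s : K ≃ₐ[ℚ] K => embOf φ₀ s ∈ Φ.1) ↔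
        t ∈ (Finset.univ.filter fun s : K ≃ₐ[ℚ] K => embOf φ₀ s ∈ Φ.1) := by
    simp only [Finset.mem_filter, Finset.mem_univ, true_and]
    constructor
    · intro h t
      rw [mul_comm, embOf_inv_mul]
      exact h _
    · intro h φ
      obtain ⟨t, rfl⟩ := (embOf_bijective φ₀).2 φ
      rw [← embOf_inv_mul, ← mul_comm t g⁻¹]
      exact h t
  rw [key]
  constructor
  · intro h
    simpa only [inv_inv] using forall_mul_inv_mem_iff h
  · intro h
    exact forall_mul_inv_mem_iff h

omit [IsCMField K] in
/-- **`g ∈ Stab(Φ) ⟺ Tg = T`** (abelian `K`). [cite: Kubota1965, §4 Lemma 2] [cite: BCLLMNO2015, §3 Prop. 3.3] -/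
theorem mem_twistStabilizer_iff_forall_mul_mem_iff (φ₀ : K →+* ℂ) (Φ : CMType K) (g : K ≃ₐ[ℚ] K) :
    g ∈ twistStabilizer Φ ↔
      ∀ t : K ≃ₐ[ℚ] K, t * g ∈ (Finset.univ.filter fun s : K ≃ₐ[ℚ] K => embOf φ₀ s ∈ Φ.1) ↔
        t ∈ (Finset.univ.filter fun s : K ≃ₐ[ℚ] K => embOf φ₀ s ∈ Φ.1) := by
  rw [mem_twistStabilizer_iff_forall_comp_mem_iff, forall_comp_mem_iff_iff_forall_mul_mem_iff φ₀]

omit [IsCMField K] in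
/-- **`|Stab(Φ)| = |Stab(T)|`** (abelian `K`). [cite: Kubota1965, §4 Lemma 2] [cite: BCLLMNO2015, §3 Prop. 3.3] -/
theorem natCard_twistStabilizer_eq_card_stabilizer (φ₀ : K →+* ℂ) (Φ : CMType K) :
    Nat.card (twistStabilizer Φ) =
      (Finset.univ.filter fun g : K ≃ₐ[ℚ] K => ∀ t : K ≃ₐ[ℚ] K,
        t * g ∈ (Finset.univ.filter fun s : K ≃ₐ[ℚ] K => embOf φ₀ s ∈ Φ.1) ↔
          t ∈ (Finset.univ.filter fun s : K ≃ₐ[ℚ] K => embOf φ₀ s ∈ Φ.1)).card := by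
  rw [← Nat.card_eq_finsetCard]
  refine Nat.card_congr (Equiv.subtypeEquivRight fun g => ?_)
  rw [mem_twistStabilizer_iff_forall_mul_mem_iff φ₀ Φ g]
  simp only [Finset.mem_filter, Finset.mem_univ, true_and]

end Dictionary

/-! ## §2 The character criterion for exceptional Hodge classes on `A` -/

section Criterion

/-- `σ_{ρg} = σ̄_g`: complex conjugation `ρ = conjGal` acts as complex conjugation under the base embedding.
[cite: Shimura1998, §18.2 Lemma (i)] -/
private theorem apply_conjGal_eq_cc (φ₀ : K →+* ℂ) (x : K) :
    φ₀ ((conjGal : K ≃ₐ[ℚ] K) x) = starRingEnd ℂ (φ₀ x) := by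
  rw [conjGal_apply, IsCMField.complexEmbedding_complexConj]

variable [IsAbelianGalois ℚ K]

/-- **Group-level invariant ⟺ `B = D` on `A`** (abelian CM field, any type, any realisation):
`2·|Stab(T)|·(rank(T) − 1) = |G| ⟺ Bᵐ(A) ⊗ ℂ = Dᵐ(A) ⊗ ℂ` for all `m`, `T = {g : σ_g ∈ Φ} ⊆ G = Gal(K/ℚ)`.
[cite: Gordon1999HodgeAVSurvey, Thm. 6.4] [cite: Kubota1965, §4 Lemma 2] [cite: White1993SporadicCycles, §4 Theorem 3] -/
theorem two_mul_card_stabilizer_mul_eq_iff_forall_hodgeClassSpan_eq (Φ : CMType K) (φ₀ : K →+* ℂ)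
    (hA : IsCMTypeRealisation Φ A ι θ) :
    2 * (Finset.univ.filter fun g : K ≃ₐ[ℚ] K => ∀ t : K ≃ₐ[ℚ] K,
          t * g ∈ (Finset.univ.filter fun s : K ≃ₐ[ℚ] K => embOf φ₀ s ∈ Φ.1) ↔
            t ∈ (Finset.univ.filter fun s : K ≃ₐ[ℚ] K => embOf φ₀ s ∈ Φ.1)).card *
        (typeRank (K ≃ₐ[ℚ] K)
          (↑(Finset.univ.filter fun s : K ≃ₐ[ℚ] K => embOf φ₀ s ∈ Φ.1) : Set (K ≃ₐ[ℚ] K)) - 1) =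
        Fintype.card (K ≃ₐ[ℚ] K) ↔
      ∀ m : ℕ, hodgeClassSpan (finrank ℚ K / 2) A.X m = divisorClassesSpan A.X (finrank ℚ K / 2) m := by
  rw [← two_mul_natCard_twistStabilizer_mul_eq_iff_forall_hodgeClassSpan_eq Φ hA,
    natCard_twistStabilizer_eq_card_stabilizer φ₀ Φ, Finset.coe_filter_univ,
    ← cmTypeRank_eq_typeRank_gal (fun g h => mul_comm g h) Φ φ₀, ← Nat.card_eq_fintype_card,
    IsGalois.card_aut_eq_finrank]

/-- **`Bᵐ(A) ⊗ ℂ = Dᵐ(A) ⊗ ℂ` for all `m` ⟺ every odd character of `Gal(K/ℚ)` trivial on `Stab(T)` has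
`Σ_{t ∈ T} χ(t) ≠ 0`** (abelian CM field, any type, any realisation). [cite: Kubota1965, §2 and §4 Lemma 2]
[cite: Pohlmann1968, Thm. 1] [cite: Gordon1999HodgeAVSurvey, Thm. 6.4] [cite: White1993SporadicCycles, §4 Theorem 3] -/
theorem forall_hodgeClassSpan_eq_iff_forall_oddCharacter (Φ : CMType K) (φ₀ : K →+* ℂ)
    (hA : IsCMTypeRealisation Φ A ι θ) :
    (∀ m : ℕ, hodgeClassSpan (finrank ℚ K / 2) A.X m = divisorClassesSpan A.X (finrank ℚ K / 2) m) ↔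
      ∀ χ : AddChar (Additive (K ≃ₐ[ℚ] K)) ℂ, χ (Additive.ofMul (conjGal : K ≃ₐ[ℚ] K)) = -1 →
        (∀ s : K ≃ₐ[ℚ] K, (∀ t : K ≃ₐ[ℚ] K,
            t * s ∈ (Finset.univ.filter fun s : K ≃ₐ[ℚ] K => embOf φ₀ s ∈ Φ.1) ↔
              t ∈ (Finset.univ.filter fun s : K ≃ₐ[ℚ] K => embOf φ₀ s ∈ Φ.1)) → χ (Additive.ofMul s) = 1) →
          ∑ s ∈ (Finset.univ.filter fun s : K ≃ₐ[ℚ] K => embOf φ₀ s ∈ Φ.1), χ (Additive.ofMul s) ≠ 0 := by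
  have hT : IsCMTypeWith (conjGal : K ≃ₐ[ℚ] K)
      (↑(Finset.univ.filter fun s : K ≃ₐ[ℚ] K => embOf φ₀ s ∈ Φ.1) : Set (K ≃ₐ[ℚ] K)) := by
    rw [Finset.coe_filter_univ]
    exact isCMTypeWith_gal (fun g h => mul_comm g h) Φ φ₀ conjGal (apply_conjGal_eq_cc φ₀)
  rw [← two_mul_card_stabilizer_mul_eq_iff_forall_hodgeClassSpan_eq Φ φ₀ hA]
  exact two_mul_card_stabilizer_mul_eq_iff hT

/-- **`A` CARRIES AN EXCEPTIONAL HODGE CLASS ⟺ SOME ODD CHARACTER, TRIVIAL ON `Stab(T)`, IS ANNIHILATED BY `T`**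
(`χ(ρ) = −1`, `χ|_{Stab(T)} = 1`, `Σ_{t ∈ T} χ(t) = 0`) — abelian CM field, any CM type, any abelian variety of the
type. [cite: Kubota1965, §2] [cite: Pohlmann1968, Thm. 1 and §3] [cite: White1993SporadicCycles, §4 Theorem 3]
[cite: Gordon1999HodgeAVSurvey, Thm. 6.4 and §9.2] -/
theorem exists_exceptional_iff_exists_oddCharacter (Φ : CMType K) (φ₀ : K →+* ℂ)
    (hA : IsCMTypeRealisation Φ A ι θ) :
    (∃ m : ℕ, ∃ c : complexBetti A.X (2 * m), IsRationalClass c ∧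
        IsOfHodgeType (finrank ℚ K / 2) A.X (2 * m) m m c ∧ c ∉ divisorClassesSpan A.X (finrank ℚ K / 2) m) ↔
      ∃ χ : AddChar (Additive (K ≃ₐ[ℚ] K)) ℂ, χ (Additive.ofMul (conjGal : K ≃ₐ[ℚ] K)) = -1 ∧
        (∀ s : K ≃ₐ[ℚ] K, (∀ t : K ≃ₐ[ℚ] K,
            t * s ∈ (Finset.univ.filter fun s : K ≃ₐ[ℚ] K => embOf φ₀ s ∈ Φ.1) ↔
              t ∈ (Finset.univ.filter fun s : K ≃ₐ[ℚ] K => embOf φ₀ s ∈ Φ.1)) → χ (Additive.ofMul s) = 1) ∧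
          ∑ s ∈ (Finset.univ.filter fun s : K ≃ₐ[ℚ] K => embOf φ₀ s ∈ Φ.1), χ (Additive.ofMul s) = 0 := by
  rw [← two_mul_natCard_twistStabilizer_mul_lt_iff_exists_exceptional Φ hA,
    (two_mul_natCard_twistStabilizer_mul_cmTypeRank_sub_one_le Φ).lt_iff_ne, Ne,
    two_mul_natCard_twistStabilizer_mul_eq_iff_forall_hodgeClassSpan_eq Φ hA,
    forall_hodgeClassSpan_eq_iff_forall_oddCharacter Φ φ₀ hA]
  constructor
  · intro h
    by_contra hne
    refine h fun χ hρ htriv hzero => hne ⟨χ, hρ, htriv, hzero⟩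
  · rintro ⟨χ, hρ, htriv, hzero⟩ h
    exact h χ hρ htriv hzero

end Criterion

end Literature.AlgebraicGeometry.Pohlmann1968
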